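import Summits.RiemannHypothesis.RiemannHypothesis.Theorems.IntegerScrewScrewPolyFloorLandauTailFloor
import Literature.NumberTheory.DiophantineGeometry.NamedHypotheses
import HarnessLib

/-!
# Route IntegerScrew — VisibilityPoly: RH up to height `M¹⁶` gives the floor at rung `M`

Helper file for crux `IntegerScrew.ScrewPolyFloor` (stmt-RiemannHypothesis-15757), idea card
`Cruxes/ScrewPolyFloor/Ideas/abscissa-blind-head.md` ("VisibilityCubed", here with the exponent 16 of
the crude Landau errors): by `tailFloor` the zeros above `M¹⁶` pay `(1/24) log M/M¹⁶ ∑y²`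
UNCONDITIONALLY, and each head term at a zero ON the critical line is
`m(ρ)|P_y(iγ)|²/γ² ≥ 0` (`headTerm_re_nonneg`). Hence (`screwFloor_of_rhUpTo`): for `M ≥ M₀`, if every
zero with `0 < Im ρ ≤ M¹⁶` has `Re ρ = ½` (`RiemannHypothesisUpTo (M¹⁶)`, the named-hypothesis form of
numerical verifications), then the crux inequality holds at rung `M` with `A = 16`, `c = 1/24`:

  `(1/24) log M/M¹⁶ ∑_{2≤m≤M} x_m² ≤ ∑_{2≤m,m'≤M} G(log m, log m') x_m x_m'`   for all real `x`

(put `y = x` on `[2, M]`, `y_1 = −∑ x`). Rung `M` of the crux is thus decided by the finitely many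
zeros below height `M¹⁶` — with no zero-density or pair-correlation input.
-/

noncomputable section

open Complex Finset
open scoped Real ComplexConjugate

-- the layout-mandated namespace repeats the summit name
set_option linter.dupNamespace false

namespace Summit.RiemannHypothesis.RiemannHypothesis.Theorems.IntegerScrewLandau

open Literature.NumberTheory.LFunctions

/-- Conjugating a Dirichlet polynomial with real coefficients conjugates the exponent:
`conj P_y(s) = P_y(conj s)`. [folklore] -/
theorem conj_dirPoly (M : ℕ) (y : ℕ → ℝ) (s : ℂ) :
    conj (∑ m ∈ Icc 1 M, ((y m : ℝ) : ℂ) * (m : ℂ) ^ s) =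
      ∑ m ∈ Icc 1 M, ((y m : ℝ) : ℂ) * (m : ℂ) ^ (conj s) := by
  rw [map_sum]
  refine Finset.sum_congr rfl fun m hm ↦ ?_
  rw [Finset.mem_Icc] at hm
  have harg : ((m : ℂ)).arg ≠ π := by
    rw [show (m : ℂ) = ((m : ℝ) : ℂ) by norm_cast, Complex.arg_ofReal_of_nonneg (Nat.cast_nonneg m)]
    exact Real.pi_pos.ne
  rw [map_mul, Complex.conj_ofReal]
  congr 1
  have h := Complex.conj_cpow (m : ℂ) (conj s) harg
  rw [Complex.conj_conj, Complex.conj_natCast] at h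
  exact h.symm

/-- **A head term at a zero on the line is non-negative**: for `Re ρ = ½`, `Im ρ ≠ 0`,
`Re[ m(ρ)·(−P_y(ρ−½)P_y(−(ρ−½)))/(ρ−½)² ] ≥ 0` (it equals `m(ρ)|P_y(iγ)|²/γ²`). [folklore] -/
theorem headTerm_re_nonneg (M : ℕ) (y : ℕ → ℝ) {ρ : ℂ} (hre : ρ.re = 1 / 2) (him : ρ.im ≠ 0)
    {k : ℤ} (hk : 0 ≤ k) :
    0 ≤ ((k : ℂ) * (-((∑ m ∈ Icc 1 M, ((y m : ℝ) : ℂ) * (m : ℂ) ^ (ρ - 1 / 2)) *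
          ∑ m ∈ Icc 1 M, ((y m : ℝ) : ℂ) * (m : ℂ) ^ (-(ρ - 1 / 2))) / (ρ - 1 / 2) ^ 2)).re := by
  set P : ℂ := ∑ m ∈ Icc 1 M, ((y m : ℝ) : ℂ) * (m : ℂ) ^ (ρ - 1 / 2) with hP
  have hs : ρ - 1 / 2 = (ρ.im : ℂ) * I := by
    apply Complex.ext
    · simp [hre]
    · simp
  have hconj : conj (ρ - 1 / 2) = -(ρ - 1 / 2) := by
    rw [hs]; simp
  have hP' : ∑ m ∈ Icc 1 M, ((y m : ℝ) : ℂ) * (m : ℂ) ^ (-(ρ - 1 / 2)) = conj P := by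
    rw [hP, conj_dirPoly, hconj]
  rw [hP']
  have hsq : (ρ - 1 / 2) ^ 2 = -((ρ.im ^ 2 : ℝ) : ℂ) := by
    rw [hs]; push_cast; ring_nf; rw [I_sq]; ring
  rw [hsq, Complex.mul_conj]
  have hval : (k : ℂ) * (-((Complex.normSq P : ℂ)) / -((ρ.im ^ 2 : ℝ) : ℂ)) =
      (((k : ℝ) * (Complex.normSq P / ρ.im ^ 2) : ℝ) : ℂ) := by
    have hγ : ((ρ.im ^ 2 : ℝ) : ℂ) ≠ 0 := by exact_mod_cast pow_ne_zero 2 him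
    push_cast
    field_simp
  rw [hval, Complex.ofReal_re]
  have : 0 ≤ Complex.normSq P / ρ.im ^ 2 := div_nonneg (Complex.normSq_nonneg _) (sq_nonneg _)
  have hk' : (0 : ℝ) ≤ k := by exact_mod_cast hk
  positivity

/-- **VisibilityPoly (RH to height `M¹⁶` ⇒ the floor at rung `M`).** There are `c > 0` and `M₀`
such that for every `M ≥ M₀`: if every zero of `ζ` with `0 < Im ρ ≤ M¹⁶` lies on the critical line
(`RiemannHypothesisUpTo (M¹⁶)`), then for all real `x`,
`c·(log M)/M¹⁶·∑_{2≤m≤M} x_m² ≤ ∑_{2≤m,m'≤M} G(log m, log m') x_m x_m'` — the crux inequality at rung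
`M` with `A = 16` (`tailFloor` + `headTerm_re_nonneg`; `y = x` on `[2,M]`, `y_1 = −∑x`). [folklore] -/
theorem screwFloor_of_rhUpTo :
    ∃ (c : ℝ) (M₀ : ℕ), 0 < c ∧ ∀ M : ℕ, M₀ ≤ M →
      Literature.NumberTheory.DiophantineGeometry.RiemannHypothesisUpTo ((M : ℝ) ^ 16) →
        ∀ x : ℕ → ℝ, c * Real.log M / (M : ℝ) ^ 16 * ∑ m ∈ Icc 2 M, x m ^ 2 ≤
          ∑ m ∈ Icc 2 M, ∑ m' ∈ Icc 2 M,
            zetaScrewKernel (Real.log m) (Real.log m') * (x m * x m') := by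
  obtain ⟨c, M₀, hc, htail⟩ := tailFloor
  refine ⟨c, max M₀ 1, hc, fun M hM hRH x ↦ ?_⟩
  classical
  have hM₀ : M₀ ≤ M := (le_max_left _ _).trans hM
  have hM1 : 1 ≤ M := (le_max_right _ _).trans hM
  -- the balanced extension
  set y : ℕ → ℝ := fun m ↦ if m = 1 then -∑ k ∈ Icc 2 M, x k else x m with hy
  have hy2 : ∀ m ∈ Icc 2 M, y m = x m := fun m hm ↦ by
    rw [Finset.mem_Icc] at hm
    simp [hy, show m ≠ 1 by omega]
  have hsplit : Icc 1 M = insert 1 (Icc 2 M) := by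
    ext k; simp only [Finset.mem_Icc, Finset.mem_insert]; omega
  have h1notin : (1 : ℕ) ∉ Icc 2 M := by simp
  have hbal : ∑ m ∈ Icc 1 M, y m = 0 := by
    rw [hsplit, Finset.sum_insert h1notin, Finset.sum_congr rfl hy2]
    simp [hy]
  have hnorm : ∑ m ∈ Icc 2 M, x m ^ 2 ≤ ∑ m ∈ Icc 1 M, y m ^ 2 := by
    have e : ∑ m ∈ Icc 2 M, y m ^ 2 = ∑ m ∈ Icc 2 M, x m ^ 2 :=
      Finset.sum_congr rfl fun m hm ↦ by rw [hy2 m hm]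
    rw [hsplit, Finset.sum_insert h1notin, e]
    linarith [sq_nonneg (y 1)]
  have hform : ∑ m ∈ Icc 2 M, ∑ m' ∈ Icc 2 M, zetaScrewKernel (Real.log m) (Real.log m') * (y m * y m') =
      ∑ m ∈ Icc 2 M, ∑ m' ∈ Icc 2 M, zetaScrewKernel (Real.log m) (Real.log m') * (x m * x m') :=
    Finset.sum_congr rfl fun m hm ↦ Finset.sum_congr rfl fun m' hm' ↦ by rw [hy2 m hm, hy2 m' hm']
  have h := htail M hM₀ y hbal
  rw [hform] at h
  -- the head is non-negative under RH up to `M¹⁶`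
  have hhead : 0 ≤ (∑ ρ ∈ SchoenfeldBound.zerosUpTo ((M : ℝ) ^ 16),
      (riemannZetaZeroOrder (ρ : ℂ) : ℂ) *
        (-((∑ m ∈ Icc 1 M, ((y m : ℝ) : ℂ) * (m : ℂ) ^ ((ρ : ℂ) - 1 / 2)) *
            ∑ m ∈ Icc 1 M, ((y m : ℝ) : ℂ) * (m : ℂ) ^ (-((ρ : ℂ) - 1 / 2))) /
          ((ρ : ℂ) - 1 / 2) ^ 2)).re := by
    rw [Complex.re_sum]
    refine Finset.sum_nonneg fun ρ hρ ↦ ?_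
    rw [SchoenfeldBound.mem_zerosUpTo] at hρ
    have hmem : (ρ : ℂ) ∈ RHWave0.riemannZetaNontrivialZeros := ρ.2
    have hζ := ZetaZeros.riemannZetaNontrivialZeros.zeta_eq_zero hmem
    have him := ZetaZeros.riemannZetaNontrivialZeros.im_ne_zero hmem
    have hk : 0 ≤ riemannZetaZeroOrder (ρ : ℂ) :=
      riemannZetaZeroOrder_nonneg (ZetaZeros.riemannZetaNontrivialZeros.ne_one hmem)
    have hre : ((ρ : ℂ)).re = 1 / 2 := by
      rcases lt_or_gt_of_ne him with hneg | hposim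
      · -- use the conjugate zero
        have hc := hRH (conj (ρ : ℂ)) (by rw [riemannZeta_conj, hζ, map_zero])
          (by rw [Complex.conj_im]; linarith)
          (by rw [Complex.conj_im]; rw [abs_of_neg hneg] at hρ; linarith)
        rwa [Complex.conj_re] at hc
      · exact hRH _ hζ hposim (by rw [abs_of_pos hposim] at hρ; exact hρ)
    exact headTerm_re_nonneg M y hre him hk
  have hlogM : 0 ≤ c * Real.log M / (M : ℝ) ^ 16 := by
    have : (1 : ℝ) ≤ M := by exact_mod_cast hM1
    have := Real.log_nonneg this
    positivity
  calc c * Real.log M / (M : ℝ) ^ 16 * ∑ m ∈ Icc 2 M, x m ^ 2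
      ≤ c * Real.log M / (M : ℝ) ^ 16 * ∑ m ∈ Icc 1 M, y m ^ 2 := mul_le_mul_of_nonneg_left hnorm hlogM
    _ ≤ _ := by linarith

/-- **ConverseVisibility (a failing rung exhibits a low off-line zero).** With the same `c > 0`
and `M₀` as in `screwFloor_of_rhUpTo`: if for some `M ≥ M₀` and some real `x` the crux inequality
`c·(log M)/M¹⁶·∑_{2≤m≤M} x_m² ≤ ∑_{2≤m,m'≤M} G(log m, log m') x_m x_m'` FAILS, then `ζ` has a zero
`ρ` off the critical line with `0 < Im ρ ≤ M¹⁶` (contrapositive of `screwFloor_of_rhUpTo`). [folklore] -/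
theorem offLine_zero_of_rung_failure :
    ∃ (c : ℝ) (M₀ : ℕ), 0 < c ∧ ∀ M : ℕ, M₀ ≤ M → ∀ x : ℕ → ℝ,
      ∑ m ∈ Icc 2 M, ∑ m' ∈ Icc 2 M, zetaScrewKernel (Real.log m) (Real.log m') * (x m * x m') <
          c * Real.log M / (M : ℝ) ^ 16 * ∑ m ∈ Icc 2 M, x m ^ 2 →
        ∃ ρ : ℂ, riemannZeta ρ = 0 ∧ 0 < ρ.im ∧ ρ.im ≤ (M : ℝ) ^ 16 ∧ ρ.re ≠ 1 / 2 := by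
  obtain ⟨c, M₀, hc, h⟩ := screwFloor_of_rhUpTo
  refine ⟨c, M₀, hc, fun M hM x hlt ↦ ?_⟩
  by_contra hno
  push Not at hno
  exact absurd (h M hM (fun s hs h0 hT ↦ hno s hs h0 hT) x) (not_le.mpr hlt)

end Summit.RiemannHypothesis.RiemannHypothesis.Theorems.IntegerScrewLandau

end
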